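import Mathlib
import HarnessLib
import Literature.Computability.QuantumComplexity.GaussianPermanentMoments
import Literature.Computability.QuantumComplexity.PermanentPairingCount

/-!
# The fourth moment of a Gaussian permanent and weak anti-concentration
# (Aaronson–Arkhipov 2013, Lemma 8.8 and Theorem 8.6)

Source: S. Aaronson, A. Arkhipov, *The computational complexity of linear optics*, Theory of
Computing 9 (2013) 143–252, §8.3 (pp. 224–227). This file completes the formalisation of the
**proved** partial result towards the (open) Permanent Anti-Concentration Conjecture
`PermanentAntiConcentrationConjecture` (§1.2.3, Conj. 1.6) stated in `QuantumAdvantageWave0.lean`: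

* `integral_norm_pow_four_permanent` — **Lemma 8.8**: `𝔼_{X ∼ 𝒩(0,1)_ℂ^{n×n}} |Per X|⁴ = (n+1)(n!)²`
  (`𝔼[P_n²] = n+1`).
* `weakPermanentAntiConcentration` — **Theorem 8.6** (Weak Anti-Concentration of the Permanent),
  unconditional: for `0 < α < 1`, `Pr[|Per X|² ≥ α · n!] > (1-α)²/(n+1)`; obtained by feeding
  Lemma 8.8 into `weakAntiConcentration_of_fourthMoment` (the printed Paley–Zygmund argument,
  `GaussianPermanentMoments.lean`).

Ingredients, following the printed proof of Lemma 8.8: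
* the law `𝒩(0,1)_ℂ` has Lebesgue density `π⁻¹ e^{-|z|²}` (`integral_stdComplexGaussian_eq_volume`),
  hence is rotation invariant (`integral_comp_circle_mul_stdComplexGaussian`) and has
  `𝔼|z|⁴ = 2` (`integral_norm_pow_four_stdComplexGaussian`, via Mathlib's
  `Complex.integral_rpow_mul_exp_neg_rpow`); the mixed moments `𝔼[z^p conj(z)^q]`, `p, q ≤ 2`,
  are `[p = q] p!` ("uniform over phases", `integral_pow_mul_conj_pow_stdComplexGaussian`);
* the Wick rule for one Gaussian row, `𝔼[x_a x_b conj(x_c) conj(x_d)] = [a=c][b=d] + [a=d][b=c]`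
  (`integral_row_four`);
* expansion of `|Per X|⁴` over `S_n⁴` and row-by-row integration (`integral_perm_term_four`);
* the count `∑_{σ,τ,α,β} ∏_i ([σi=αi][τi=βi] + [σi=βi][τi=αi]) = (n+1)(n!)²`
  (`PermanentPairing.fourthMomentPairingCount`, file `PermanentPairingCount.lean`; the source
  counts the same quantity as `n! · E_ξ[2^{cyc ξ}]` via Proposition 8.7, we count stabilisers of
  subsets instead — same number).

Design: as in `GaussianPermanentMoments.lean`, Theorem 8.6 is stated for `0 < α < 1` (printed
"`α < 1`"; false as printed for `α ≤ 1 - √(n+1)` and for `(n, α) = (0,0)`). Not here: §8.4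
(higher moments, Theorem 8.10), Theorem 8.2 (determinant), Conjecture 1.6 itself (open).
-/

namespace Literature.Computability.QuantumComplexity

open _root_.MeasureTheory _root_.ProbabilityTheory
open scoped ENNReal NNReal ComplexConjugate Real

section StdComplexGaussianDensity

/-- The product of the two marginal densities of `stdComplexGaussian` is `π⁻¹ e^{-(x²+y²)}`.
[folklore] -/
theorem gaussianPDFReal_half_mul (x y : ℝ) :
    gaussianPDFReal 0 (1 / 2 : ℝ≥0) x * gaussianPDFReal 0 (1 / 2 : ℝ≥0) y =
      π⁻¹ * Real.exp (-(x ^ 2 + y ^ 2)) := by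
  have h2 : ((1 / 2 : ℝ≥0) : ℝ) = 1 / 2 := by norm_num
  simp only [gaussianPDFReal, h2, sub_zero]
  rw [show (2 : ℝ) * π * (1 / 2) = π by ring, show (2 : ℝ) * (1 / 2) = 1 by norm_num, div_one,
    div_one, mul_mul_mul_comm, ← mul_inv, Real.mul_self_sqrt Real.pi_pos.le, ← Real.exp_add,
    neg_add]

/-- `stdComplexGaussian` has density `π⁻¹ e^{-|z|²}` with respect to Lebesgue measure on `ℂ`
(Aaronson–Arkhipov 2013, §2: the standard complex normal law), in integral form. [folklore] -/
theorem integral_stdComplexGaussian_eq_volume {E : Type*} [NormedAddCommGroup E]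
    [NormedSpace ℝ E] (f : ℂ → E) :
    ∫ z, f z ∂stdComplexGaussian = ∫ z : ℂ, (π⁻¹ * Real.exp (-‖z‖ ^ 2)) • f z := by
  rw [integral_stdComplexGaussian]
  have hv : (1 / 2 : ℝ≥0) ≠ 0 := by norm_num
  have hmeas : Measurable fun z : ℝ × ℝ =>
      gaussianPDF 0 (1 / 2 : ℝ≥0) z.1 * gaussianPDF 0 (1 / 2 : ℝ≥0) z.2 :=
    ((measurable_gaussianPDF _ _).comp measurable_fst).mul
      ((measurable_gaussianPDF _ _).comp measurable_snd)
  rw [gaussianReal_of_var_ne_zero 0 hv,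
    prod_withDensity (measurable_gaussianPDF 0 _) (measurable_gaussianPDF 0 _),
    ← Measure.volume_eq_prod,
    integral_withDensity_eq_integral_toReal_smul hmeas
      (ae_of_all _ fun p => ENNReal.mul_lt_top gaussianPDF_lt_top gaussianPDF_lt_top)]
  symm
  calc ∫ z : ℂ, (π⁻¹ * Real.exp (-‖z‖ ^ 2)) • f z
      = ∫ z : ℂ, (fun p : ℝ × ℝ => (gaussianPDF 0 (1 / 2 : ℝ≥0) p.1 *
          gaussianPDF 0 (1 / 2 : ℝ≥0) p.2).toReal • f ⟨p.1, p.2⟩)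
            (Complex.measurableEquivRealProd z) := by
        congr 1
        funext z
        simp only [Complex.measurableEquivRealProd_apply, gaussianPDF, ENNReal.toReal_mul,
          ENNReal.toReal_ofReal (gaussianPDFReal_nonneg _ _ _), gaussianPDFReal_half_mul]
        congr 2
        · rw [Complex.sq_norm, Complex.normSq_apply]; ring
    _ = _ := Complex.volume_preserving_equiv_real_prod.integral_comp'
          (fun p : ℝ × ℝ => (gaussianPDF 0 (1 / 2 : ℝ≥0) p.1 *
            gaussianPDF 0 (1 / 2 : ℝ≥0) p.2).toReal • f ⟨p.1, p.2⟩)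

/-- Rotation invariance of `𝒩(0,1)_ℂ`: for `a` on the unit circle, `z ↦ a z` preserves
`stdComplexGaussian` (in integral form). [folklore] -/
theorem integral_comp_circle_mul_stdComplexGaussian {E : Type*} [NormedAddCommGroup E]
    [NormedSpace ℝ E] (a : Circle) (f : ℂ → E) :
    ∫ z, f (a * z) ∂stdComplexGaussian = ∫ z, f z ∂stdComplexGaussian := by
  rw [integral_stdComplexGaussian_eq_volume, integral_stdComplexGaussian_eq_volume]
  have h := MeasureTheory.integral_comp (rotation a)
    (fun z : ℂ => (π⁻¹ * Real.exp (-‖z‖ ^ 2)) • f z)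
  simp only [rotation_apply, norm_mul, Circle.norm_coe, one_mul] at h
  exact h

/-- `𝔼 |z|⁴ = 2` for `z ∼ 𝒩(0,1)_ℂ` (Aaronson–Arkhipov 2013, proof of Lemma 8.8: "`E[|x|⁴] = 2`").
[cite: AaronsonArkhipovToC2013, Lemma 8.8 proof p. 226] -/
theorem integral_norm_pow_four_stdComplexGaussian :
    ∫ z, ‖z‖ ^ 4 ∂stdComplexGaussian = 2 := by
  rw [integral_stdComplexGaussian_eq_volume]
  have key := Complex.integral_rpow_mul_exp_neg_rpow (p := 2) (q := 4) (by norm_num) (by norm_num)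
  have h3 : ((4 : ℝ) + 2) / 2 = 3 := by norm_num
  rw [h3, show (3 : ℝ) = (2 : ℕ) + 1 by norm_num, Real.Gamma_nat_eq_factorial] at key
  simp only [Real.rpow_ofNat] at key
  simp_rw [smul_eq_mul, mul_assoc]
  rw [integral_const_mul]
  simp_rw [mul_comm (Real.exp _)]
  rw [key]
  simp [Nat.factorial]

/-- Scaling out a unit scalar: `𝔼[(az)^p conj(az)^q] = a^p conj(a)^q 𝔼[z^p conj(z)^q]`
combined with rotation invariance. [folklore] -/
theorem circle_pow_mul_integral_pow_mul_conj_pow (a : Circle) (p q : ℕ) :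
    ((a : ℂ) ^ p * conj (a : ℂ) ^ q) * ∫ z, z ^ p * conj z ^ q ∂stdComplexGaussian =
      ∫ z, z ^ p * conj z ^ q ∂stdComplexGaussian := by
  rw [← integral_const_mul,
    ← integral_comp_circle_mul_stdComplexGaussian a (fun z => z ^ p * conj z ^ q)]
  congr 1
  funext z
  simp only [mul_pow, map_mul]
  ring

/-- Mixed moments of odd total degree vanish: `𝔼[z^p conj(z)^q] = 0` if `p + q` is odd
(invariance under `z ↦ -z`). [folklore] -/
theorem integral_pow_mul_conj_pow_eq_zero_of_odd (p q : ℕ) (h : Odd (p + q)) :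
    ∫ z, z ^ p * conj z ^ q ∂stdComplexGaussian = 0 := by
  have key := circle_pow_mul_integral_pow_mul_conj_pow (-1) p q
  simp only [Circle.coe_neg, Circle.coe_one, map_neg, map_one] at key
  rw [← pow_add, h.neg_one_pow] at key
  linear_combination (-1 / 2 : ℂ) * key

/-- `𝔼 z² = 0` and `𝔼 conj(z)² = 0` (invariance under `z ↦ iz`). [folklore] -/
theorem integral_sq_stdComplexGaussian :
    ∫ z, z ^ 2 ∂stdComplexGaussian = 0 ∧ ∫ z, conj z ^ 2 ∂stdComplexGaussian = 0 := by
  have hI : Complex.I ∈ Submonoid.unitSphere ℂ := by simp [Submonoid.unitSphere]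
  have k1 := circle_pow_mul_integral_pow_mul_conj_pow ⟨Complex.I, hI⟩ 2 0
  have k2 := circle_pow_mul_integral_pow_mul_conj_pow ⟨Complex.I, hI⟩ 0 2
  simp only [Complex.conj_I, pow_zero, mul_one, one_mul] at k1 k2
  rw [Complex.I_sq] at k1
  rw [neg_sq, Complex.I_sq] at k2
  constructor
  · linear_combination (-1 / 2 : ℂ) * k1
  · linear_combination (-1 / 2 : ℂ) * k2

/-- **Mixed moments of `𝒩(0,1)_ℂ` up to order `(2,2)`**: for `p, q ≤ 2`,
`𝔼[z^p conj(z)^q] = [p = q] · p!` (so `𝔼|z|² = 1`, `𝔼|z|⁴ = 2`, all other mixed moments vanish;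
"the Gaussian distribution is uniform over phases", Aaronson–Arkhipov 2013, proof of Lemma 8.8).
[cite: AaronsonArkhipovToC2013, Lemma 8.8 proof p. 226] -/
theorem integral_pow_mul_conj_pow_stdComplexGaussian (p q : ℕ) (hp : p ≤ 2) (hq : q ≤ 2) :
    ∫ z, z ^ p * conj z ^ q ∂stdComplexGaussian = if p = q then (p.factorial : ℂ) else 0 := by
  have h11 : ∫ z, z ^ 1 * conj z ^ 1 ∂stdComplexGaussian = 1 := by
    have e : ∀ z : ℂ, z ^ 1 * conj z ^ 1 = ((‖z‖ ^ 2 : ℝ) : ℂ) := fun z => by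
      rw [pow_one, pow_one, Complex.mul_conj, Complex.normSq_eq_norm_sq]
    simp_rw [e, integral_complex_ofReal, integral_norm_sq_stdComplexGaussian, Complex.ofReal_one]
  have h22 : ∫ z, z ^ 2 * conj z ^ 2 ∂stdComplexGaussian = 2 := by
    have e : ∀ z : ℂ, z ^ 2 * conj z ^ 2 = ((‖z‖ ^ 4 : ℝ) : ℂ) := fun z => by
      rw [← mul_pow, Complex.mul_conj, Complex.normSq_eq_norm_sq]
      push_cast
      ring
    simp_rw [e, integral_complex_ofReal, integral_norm_pow_four_stdComplexGaussian,
      Complex.ofReal_ofNat]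
  interval_cases p <;> interval_cases q
  · simp
  · simpa using integral_pow_mul_conj_pow_eq_zero_of_odd 0 1 (by decide)
  · simpa using integral_sq_stdComplexGaussian.2
  · simpa using integral_pow_mul_conj_pow_eq_zero_of_odd 1 0 (by decide)
  · simpa using h11
  · simpa using integral_pow_mul_conj_pow_eq_zero_of_odd 1 2 (by decide)
  · simpa using integral_sq_stdComplexGaussian.1
  · simpa using integral_pow_mul_conj_pow_eq_zero_of_odd 2 1 (by decide)
  · simpa [Nat.factorial] using h22

end StdComplexGaussianDensity

section RowWick

/-- Two indicator sums `[a = ·] + [b = ·]` and `[c = ·] + [d = ·]` agree iff `{a, b} = {c, d}` as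
multisets, i.e. iff `(a, b)` is `(c, d)` or `(d, c)`. [folklore] -/
theorem ind_add_ind_eq_iff {ι : Type*} [DecidableEq ι] (a b c d : ι) :
    (∀ j, ((if a = j then 1 else 0) + (if b = j then 1 else 0) : ℕ) =
        (if c = j then 1 else 0) + (if d = j then 1 else 0)) ↔
      (a = c ∧ b = d) ∨ (a = d ∧ b = c) := by
  constructor
  · intro h
    have ha := h a
    have hb := h b
    rw [if_pos rfl] at ha hb
    by_cases hca : c = a
    · subst hca
      left
      refine ⟨rfl, ?_⟩
      by_cases hdb : d = b
      · exact hdb.symm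
      · exfalso
        by_cases hbc : b = c
        · subst hbc
          simp [hdb] at ha
        · rw [if_neg (Ne.symm hbc), if_neg hdb] at hb
          simp at hb
    · by_cases hda : d = a
      · subst hda
        right
        refine ⟨rfl, ?_⟩
        by_cases hcb : c = b
        · exact hcb.symm
        · exfalso
          by_cases hbd : b = d
          · subst hbd
            simp [hca] at ha
          · rw [if_neg (Ne.symm hbd), if_neg hcb] at hb
            simp at hb
      · rw [if_neg hca, if_neg hda] at ha
        simp at ha
  · rintro (⟨rfl, rfl⟩ | ⟨rfl, rfl⟩) <;> intro j
    · rfl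
    · exact add_comm _ _

/-- `∏_j ([a = j] + [b = j])! = 2` if `a = b` and `1` otherwise. [folklore] -/
theorem prod_factorial_ind_add_ind {ι : Type*} [Fintype ι] [DecidableEq ι] (a b : ι) :
    ∏ j, ((((if a = j then 1 else 0) + (if b = j then 1 else 0) : ℕ).factorial : ℕ) : ℂ) =
      if a = b then 2 else 1 := by
  by_cases hab : a = b
  · subst hab
    rw [if_pos rfl]
    have h : ∀ j, ((((if a = j then 1 else 0) + (if a = j then 1 else 0) : ℕ).factorial : ℕ) : ℂ) =
        if a = j then 2 else 1 := by
      intro j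
      by_cases hj : a = j <;> simp [hj]
    simp_rw [h]
    rw [Finset.prod_ite_eq]
    simp
  · rw [if_neg hab]
    refine Finset.prod_eq_one fun j _ => ?_
    by_cases h1 : a = j <;> by_cases h2 : b = j
    · exact absurd (h1.trans h2.symm) hab
    all_goals simp [h1, h2]

variable (n : ℕ)

/-- Degree-four monomials in the entries of a Gaussian row are integrable. [folklore] -/
theorem integrable_row_four (a b c d : Fin n) :
    Integrable (fun r : Fin n → ℂ => r a * r b * conj (r c) * conj (r d))
      (gaussianRowMeasure n) := by
  have hM : MemLp (fun r : Fin n → ℂ => ∑ j, ‖r j‖) 4 (gaussianRowMeasure n) :=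
    memLp_finsetSum _ (fun j _ => (memLp_eval_gaussianRowMeasure n j 4 (by simp)).norm)
  have hM4 : Integrable (fun r : Fin n → ℂ => (∑ j, ‖r j‖) ^ 4) (gaussianRowMeasure n) := by
    have h := hM.integrable_norm_rpow (by simp) (by simp)
    refine h.congr (ae_of_all _ fun r => ?_)
    simp only [ENNReal.toReal_ofNat, Real.rpow_ofNat]
    rw [Real.norm_of_nonneg (Finset.sum_nonneg fun j _ => norm_nonneg _)]
  refine hM4.mono' (Continuous.aestronglyMeasurable (by fun_prop)) (ae_of_all _ fun r => ?_)
  have hle : ∀ j, ‖r j‖ ≤ ∑ k, ‖r k‖ := fun j =>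
    Finset.single_le_sum (fun k _ => norm_nonneg (r k)) (Finset.mem_univ j)
  calc ‖r a * r b * conj (r c) * conj (r d)‖ = ‖r a‖ * ‖r b‖ * ‖r c‖ * ‖r d‖ := by
        simp only [norm_mul, Complex.norm_conj]
    _ ≤ (∑ k, ‖r k‖) * (∑ k, ‖r k‖) * (∑ k, ‖r k‖) * (∑ k, ‖r k‖) := by
        gcongr <;> exact hle _
    _ = (∑ k, ‖r k‖) ^ 4 := by ring

/-- **Wick rule for a Gaussian row** (Aaronson–Arkhipov 2013, proof of Lemma 8.8, p. 226: the
expectation vanishes unless every entry is paired with its conjugate, a paired entry contributes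
`E|x|² = 1` and a doubly paired one `E|x|⁴ = 2`):
`𝔼[x_a x_b conj(x_c) conj(x_d)] = [a = c ∧ b = d] + [a = d ∧ b = c]`.
[cite: AaronsonArkhipovToC2013, Lemma 8.8 proof p. 226] -/
theorem integral_row_four (a b c d : Fin n) :
    ∫ r, r a * r b * conj (r c) * conj (r d) ∂gaussianRowMeasure n =
      (((if a = c ∧ b = d then 1 else 0) + (if a = d ∧ b = c then 1 else 0) : ℕ) : ℂ) := by
  have hprod : ∀ r : Fin n → ℂ, r a * r b * conj (r c) * conj (r d) =
      ∏ j, (r j ^ ((if a = j then 1 else 0) + (if b = j then 1 else 0) : ℕ) *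
        conj (r j) ^ ((if c = j then 1 else 0) + (if d = j then 1 else 0) : ℕ)) := by
    intro r
    simp only [pow_add, Finset.prod_mul_distrib, Finset.prod_pow_boole, Finset.mem_univ,
      if_true]
    ring
  simp_rw [hprod]
  rw [show gaussianRowMeasure n = Measure.pi (fun _ : Fin n => stdComplexGaussian) from rfl,
    integral_fintype_prod_eq_prod
      (f := fun j (z : ℂ) => z ^ ((if a = j then 1 else 0) + (if b = j then 1 else 0) : ℕ) *
        conj z ^ ((if c = j then 1 else 0) + (if d = j then 1 else 0) : ℕ))]
  have hle : ∀ (x y j : Fin n), ((if x = j then 1 else 0) + (if y = j then 1 else 0) : ℕ) ≤ 2 := by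
    intro x y j
    by_cases hx : x = j <;> by_cases hy : y = j <;> simp [hx, hy]
  simp_rw [integral_pow_mul_conj_pow_stdComplexGaussian _ _ (hle a b _) (hle c d _)]
  rw [Fintype.prod_ite_zero, prod_factorial_ind_add_ind]
  by_cases hP : (a = c ∧ b = d) ∨ (a = d ∧ b = c)
  · rw [if_pos ((ind_add_ind_eq_iff a b c d).mpr hP)]
    rcases hP with ⟨rfl, rfl⟩ | ⟨rfl, rfl⟩
    · by_cases hab : a = b
      · subst hab; simp
      · simp [hab]
    · by_cases hab : a = b
      · subst hab; simp
      · simp [hab, Ne.symm hab]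
  · rw [if_neg (mt (ind_add_ind_eq_iff a b c d).mp hP)]
    have h1 : ¬(a = c ∧ b = d) := fun h => hP (Or.inl h)
    have h2 : ¬(a = d ∧ b = c) := fun h => hP (Or.inr h)
    simp [h1, h2]

end RowWick

section FourthMoment

variable (n : ℕ)

/-- Expansion of `|Per X|⁴ = Per X · Per X · conj(Per X) · conj(Per X)` over `S_n⁴`
(Aaronson–Arkhipov 2013, first display in the proof of Lemma 8.8, p. 225).
[cite: AaronsonArkhipovToC2013, Lemma 8.8 proof p. 225] -/
theorem norm_pow_four_permanent_eq_sum (X : Fin n → Fin n → ℂ) :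
    ((‖(Matrix.of X).permanent‖ ^ 4 : ℝ) : ℂ) =
      ∑ σ : Equiv.Perm (Fin n), ∑ τ : Equiv.Perm (Fin n),
        ∑ α : Equiv.Perm (Fin n), ∑ β : Equiv.Perm (Fin n),
          ∏ i, (X i (σ i) * X i (τ i) * conj (X i (α i)) * conj (X i (β i))) := by
  have h : ((‖(Matrix.of X).permanent‖ ^ 4 : ℝ) : ℂ) =
      (Matrix.of X).permanent * ((Matrix.of X).permanent *
        (conj (Matrix.of X).permanent * conj (Matrix.of X).permanent)) := by
    rw [show ((‖(Matrix.of X).permanent‖ ^ 4 : ℝ) : ℂ) =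
        (((‖(Matrix.of X).permanent‖ ^ 2 : ℝ) : ℂ)) ^ 2 by push_cast; ring,
      ← Complex.normSq_eq_norm_sq, ← Complex.mul_conj]
    ring
  rw [h, permanent_of_eq_sum, map_sum]
  simp_rw [map_prod]
  simp only [Finset.sum_mul]
  simp only [Finset.mul_sum]
  refine Finset.sum_congr rfl fun σ _ => Finset.sum_congr rfl fun τ _ =>
    Finset.sum_congr rfl fun α _ => Finset.sum_congr rfl fun β _ => ?_
  rw [← Finset.prod_mul_distrib, ← Finset.prod_mul_distrib, ← Finset.prod_mul_distrib]
  exact Finset.prod_congr rfl fun i _ => by ring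

/-- Each term of the `S_n⁴` expansion of `|Per X|⁴` is integrable against the Gaussian
ensemble. [folklore] -/
theorem integrable_perm_term_four (σ τ α β : Equiv.Perm (Fin n)) :
    Integrable (fun X : Fin n → Fin n → ℂ =>
      ∏ i, (X i (σ i) * X i (τ i) * conj (X i (α i)) * conj (X i (β i))))
      (gaussianMatrixMeasure n) := by
  rw [gaussianMatrixMeasure_eq_pi]
  exact Integrable.fintype_prod
    (f := fun i (r : Fin n → ℂ) => r (σ i) * r (τ i) * conj (r (α i)) * conj (r (β i)))
    (fun i => integrable_row_four n _ _ _ _)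

/-- Row-by-row integration of a term of the expansion (Aaronson–Arkhipov 2013, proof of
Lemma 8.8, pp. 225–226: independence of the rows and the Wick rule):
`𝔼 ∏_i X_{iσ(i)} X_{iτ(i)} conj X_{iα(i)} conj X_{iβ(i)}
  = ∏_i ([σ i = α i ∧ τ i = β i] + [σ i = β i ∧ τ i = α i])`.
[cite: AaronsonArkhipovToC2013, Lemma 8.8 proof pp. 225–226] -/
theorem integral_perm_term_four (σ τ α β : Equiv.Perm (Fin n)) :
    ∫ X, ∏ i, (X i (σ i) * X i (τ i) * conj (X i (α i)) * conj (X i (β i)))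
        ∂gaussianMatrixMeasure n =
      ((∏ i, ((if σ i = α i ∧ τ i = β i then 1 else 0) +
        (if σ i = β i ∧ τ i = α i then 1 else 0)) : ℕ) : ℂ) := by
  rw [gaussianMatrixMeasure_eq_pi, integral_fintype_prod_eq_prod
    (f := fun i (r : Fin n → ℂ) => r (σ i) * r (τ i) * conj (r (α i)) * conj (r (β i)))]
  simp_rw [integral_row_four]
  rw [Nat.cast_prod]

/-- **Lemma 8.8 of Aaronson–Arkhipov 2013** (fourth moment of the Gaussian permanent):
`𝔼_{X ∼ 𝒩(0,1)_ℂ^{n×n}} |Per X|⁴ = (n+1) · (n!)²`, i.e. `𝔼[P_n²] = n + 1` for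
`P_n := |Per X|² / n!`. Proof as printed (pp. 225–227): expand over `S_n⁴`, integrate the
independent rows with the Wick rule (`integral_perm_term_four`), and count
(`PermanentPairing.fourthMomentPairingCount`, where the printed `E_ξ[2^{cyc ξ}] = n+1` count is
re-organised as `∑_t |t|!(n-|t|)! = (n+1)!`). [cite: AaronsonArkhipovToC2013, Lemma 8.8 p. 225] -/
theorem integral_norm_pow_four_permanent :
    ∫ X, ‖(Matrix.of X).permanent‖ ^ 4 ∂gaussianMatrixMeasure n =
      ((n : ℝ) + 1) * ((n.factorial : ℝ)) ^ 2 := by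
  have hint := integrable_perm_term_four n
  apply Complex.ofReal_injective
  rw [← integral_complex_ofReal]
  simp_rw [norm_pow_four_permanent_eq_sum]
  rw [integral_finsetSum _ fun σ _ => integrable_finsetSum _ fun τ _ =>
    integrable_finsetSum _ fun α _ => integrable_finsetSum _ fun β _ => hint σ τ α β]
  simp_rw [integral_finsetSum _ fun τ _ => integrable_finsetSum _ fun α _ =>
    integrable_finsetSum _ fun β _ => hint _ τ α β,
    integral_finsetSum _ fun α _ => integrable_finsetSum _ fun β _ => hint _ _ α β,
    integral_finsetSum _ fun β _ => hint _ _ _ β, integral_perm_term_four]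
  simp only [← Nat.cast_sum]
  rw [PermanentPairing.fourthMomentPairingCount]
  norm_num

/-- Lemma 8.8 as printed, for the normalised variable `P_n := |Per X|²/n!`: `𝔼[P_n²] = n + 1`.
[cite: AaronsonArkhipovToC2013, Lemma 8.8 p. 225] -/
theorem integral_normSqPerm_sq :
    ∫ X, (‖(Matrix.of X).permanent‖ ^ 2 / (n.factorial : ℝ)) ^ 2 ∂gaussianMatrixMeasure n =
      (n : ℝ) + 1 := by
  have hfac : (n.factorial : ℝ) ≠ 0 := by exact_mod_cast (Nat.factorial_pos n).ne'
  simp_rw [div_pow, ← pow_mul]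
  rw [integral_div, integral_norm_pow_four_permanent]
  field_simp

/-- `𝔼[P_n] = 1` for `P_n := |Per X|²/n!` (Aaronson–Arkhipov 2013, §8 p. 219, the normalisation
used throughout §8.3). [cite: AaronsonArkhipovToC2013, §8 p. 219] -/
theorem integral_normSqPerm :
    ∫ X, ‖(Matrix.of X).permanent‖ ^ 2 / (n.factorial : ℝ) ∂gaussianMatrixMeasure n = 1 := by
  have hfac : (n.factorial : ℝ) ≠ 0 := by exact_mod_cast (Nat.factorial_pos n).ne'
  rw [integral_div, integral_norm_sq_permanent, div_self hfac]

/-- `|Per X|⁴` is integrable against the Gaussian ensemble (all Gaussian moments are finite).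
[folklore] -/
theorem integrable_norm_pow_four_permanent :
    Integrable (fun X : Fin n → Fin n → ℂ => ‖(Matrix.of X).permanent‖ ^ 4)
      (gaussianMatrixMeasure n) := by
  refine Integrable.of_integral_ne_zero ?_
  rw [integral_norm_pow_four_permanent]
  positivity

/-- **Theorem 8.6 of Aaronson–Arkhipov 2013** (Weak Anti-Concentration of the Permanent, §8.3,
p. 224, eq. (8.42)), now unconditional: for `X ∼ 𝒩(0,1)_ℂ^{n×n}` and `0 < α < 1`,
`Pr[|Per X|² ≥ α · n!] > (1-α)²/(n+1)`.
Obtained from `weakAntiConcentration_of_fourthMoment` (the printed Paley–Zygmund proof, p. 227)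
and Lemma 8.8 (`integral_norm_pow_four_permanent`). Printed "for all `α < 1`"; the restriction
`0 < α` is discussed at `weakAntiConcentration_of_fourthMoment` (the printed bound is false for
`α ≤ 1 - √(n+1)` and for `(n, α) = (0, 0)`). This is the proved weak form of the (open)
Permanent Anti-Concentration Conjecture `PermanentAntiConcentrationConjecture`.
[cite: AaronsonArkhipovToC2013, Thm 8.6 p. 224] -/
theorem weakPermanentAntiConcentration (α : ℝ) (hα0 : 0 < α) (hα1 : α < 1) :
    (1 - α) ^ 2 / ((n : ℝ) + 1) <
      (gaussianMatrixMeasure n).real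
        {X | α * (n.factorial : ℝ) ≤ ‖(Matrix.of X).permanent‖ ^ 2} :=
  weakAntiConcentration_of_fourthMoment n (integral_norm_pow_four_permanent n) α hα0 hα1

/-- Theorem 8.6 in the normalised form of the source, `Pr[P_n ≥ α] > (1-α)²/(n+1)` with
`P_n = |Per X|²/n!`. [cite: AaronsonArkhipovToC2013, Thm 8.6 p. 224] -/
theorem weakPermanentAntiConcentration' (α : ℝ) (hα0 : 0 < α) (hα1 : α < 1) :
    (1 - α) ^ 2 / ((n : ℝ) + 1) <
      (gaussianMatrixMeasure n).real
        {X | α ≤ ‖(Matrix.of X).permanent‖ ^ 2 / (n.factorial : ℝ)} := by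
  have hfac : (0 : ℝ) < n.factorial := by exact_mod_cast Nat.factorial_pos n
  convert weakPermanentAntiConcentration n α hα0 hα1 using 2
  ext X
  simp only [Set.mem_setOf_eq]
  rw [le_div_iff₀ hfac]

end FourthMoment

end Literature.Computability.QuantumComplexity
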